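import Literature.Topology.FourManifolds.TwistCoords
import Literature.Topology.FourManifolds.MonotoneInverse
import Mathlib.Analysis.SpecialFunctions.Trigonometric.Deriv
import HarnessLib

/-!
# The tilted stub in the twisted chart is a graph

Topic `Literature/Topology/FourManifolds`; fact seat `provefact-IsStrictHandleSlide.isSurgery`
(R. C. Kirby, *The Topology of 4-Manifolds*, LNM 1374 (1989), Ch. I §4; remaining content: the
named fact (S) `Literature.Topology.FourManifolds.FramedLink.IsStrictHandleSlide.slideModel`).
In the slice picture of the pillbox sweep the common **stub** of the two attaching circles near a
tip is the tilted ray `θ = θ_T + ι (r - r_T)` (polar coordinates). Under the angular twist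
(`TwistCoords.lean`) its image is the curve `r ↦ (r cos α(r), r sin α(r))`,
`α(r) = twistAngle c r (θ_T + ι (r - r_T))`. This file computes `d/dr` of the twist angle along
the stub and of the second coordinate `Y(r) = r sin α(r)`, shows `Y'(r_T) = 1` when the tip is
twisted to the vertical (`α(r_T) = π/2`), hence that `Y` is strictly increasing near `r_T`: the
twisted stub is a graph over the second coordinate there. Proved here (no definitions, no named
facts):

* `hasDerivAt_twistAngle_stub`, `hasDerivAt_stubY`, `deriv_stubY_tip`,
  `exists_deriv_stubY_pos`, `exists_strictMonoOn_stubY`.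

## References

* R. C. Kirby, *The Topology of 4-Manifolds*, LNM 1374, Springer (1989), Ch. I §4. [Kirby1989]
* M. W. Hirsch, *Differential Topology* (1976), Ch. 8 §1. [HirschDT1976]
-/

open scoped Topology Real ContDiff
open Set Real Filter

noncomputable section

namespace Literature.Topology.FourManifolds

variable {c ι θT rT : ℝ}

/-- **The twist angle along the tilted stub**: for `θ(r) = θ_T + ι (r - r_T) ∈ (-π, π)`,
`d/dr twistAngle c r (θ r) = c sin α + ι E / (cos² (θ/2) + E² sin² (θ/2))`, `E = e^{cr}`,
`α = twistAngle c r (θ r)`. [folklore] -/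
theorem hasDerivAt_twistAngle_stub (c ι θT rT : ℝ) {r : ℝ} (hθ : θT + ι * (r - rT) ∈ Ioo (-π) π) :
    HasDerivAt (fun r ↦ twistAngle c r (θT + ι * (r - rT)))
      (c * sin (twistAngle c r (θT + ι * (r - rT))) +
        ι * (exp (c * r) / (cos ((θT + ι * (r - rT)) / 2) ^ 2 +
          exp (c * r) ^ 2 * sin ((θT + ι * (r - rT)) / 2) ^ 2))) r := by
  have hc : 0 < cos ((θT + ι * (r - rT)) / 2) := cos_pos_of_mem_Ioo ⟨by linarith [hθ.1], by linarith [hθ.2]⟩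
  have hEp : 0 < exp (c * r) := exp_pos _
  have h1 : HasDerivAt (fun r ↦ c * r) c r := by simpa using (hasDerivAt_id r).const_mul c
  have hexp : HasDerivAt (fun r ↦ exp (c * r)) (exp (c * r) * c) r := h1.exp
  have hθ' : HasDerivAt (fun r ↦ (θT + ι * (r - rT)) / 2) (ι / 2) r := by
    have := (((hasDerivAt_id r).sub_const rT).const_mul ι).const_add θT
    simpa using this.div_const 2
  have htan := (hasDerivAt_tan hc.ne').comp r hθ'
  have hprod := hexp.mul htan
  have ha := ((hasDerivAt_arctan (exp (c * r) * tan ((θT + ι * (r - rT)) / 2))).comp r hprod).const_mul 2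
  refine (ha.congr_of_eventuallyEq (Eventually.of_forall fun x ↦ rfl)).congr_deriv ?_
  simp only [Function.comp_def]
  rw [sin_twistAngle_eq, tan_eq_sin_div_cos]
  have hc2 : cos ((θT + ι * (r - rT)) / 2) ≠ 0 := hc.ne'
  have hden : cos ((θT + ι * (r - rT)) / 2) ^ 2 + exp (c * r) ^ 2 * sin ((θT + ι * (r - rT)) / 2) ^ 2 ≠ 0 := by
    positivity
  field_simp

/-- **The second twisted coordinate along the stub**, `Y(r) = r sin α(r)`:
`Y'(r) = sin α + r cos α · α'(r)`. [folklore] -/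
theorem hasDerivAt_stubY (c ι θT rT : ℝ) {r : ℝ} (hθ : θT + ι * (r - rT) ∈ Ioo (-π) π) :
    HasDerivAt (fun r ↦ r * sin (twistAngle c r (θT + ι * (r - rT))))
      (sin (twistAngle c r (θT + ι * (r - rT))) +
        r * (cos (twistAngle c r (θT + ι * (r - rT))) *
          (c * sin (twistAngle c r (θT + ι * (r - rT))) +
            ι * (exp (c * r) / (cos ((θT + ι * (r - rT)) / 2) ^ 2 +
              exp (c * r) ^ 2 * sin ((θT + ι * (r - rT)) / 2) ^ 2))))) r := by
  have hα := hasDerivAt_twistAngle_stub c ι θT rT hθ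
  have := (hasDerivAt_id r).mul hα.sin
  refine this.congr_deriv ?_
  simp only [id]
  ring

/-- **At a tip twisted to the vertical the stub graph has slope one**: if `α(r_T) = π/2` then
`Y'(r_T) = 1`. [folklore] -/
theorem deriv_stubY_tip (c ι : ℝ) {θT : ℝ} (rT : ℝ) (hθT : θT ∈ Ioo (-π) π)
    (htip : twistAngle c rT θT = π / 2) :
    deriv (fun r ↦ r * sin (twistAngle c r (θT + ι * (r - rT)))) rT = 1 := by
  have h0 : θT + ι * (rT - rT) = θT := by ring
  have hθ : θT + ι * (rT - rT) ∈ Ioo (-π) π := by rw [h0]; exact hθT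
  have hd := hasDerivAt_stubY c ι θT rT hθ
  rw [h0, htip] at hd
  simp only [sin_pi_div_two, cos_pi_div_two, zero_mul, mul_zero, add_zero] at hd
  exact hd.deriv

/-- The second twisted coordinate along the stub is `C^∞` on any interval where the stub angle
stays in `(-π, π)`. [folklore] -/
theorem contDiffOn_stubY (c ι θT rT : ℝ) {u v : ℝ} (huv : ∀ r ∈ Ioo u v, θT + ι * (r - rT) ∈ Ioo (-π) π) :
    ContDiffOn ℝ ∞ (fun r ↦ r * sin (twistAngle c r (θT + ι * (r - rT)))) (Ioo u v) := by
  have hmap : MapsTo (fun r : ℝ ↦ (r, θT + ι * (r - rT))) (Ioo u v) (univ ×ˢ Ioo (-π) π) :=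
    fun r hr ↦ ⟨mem_univ _, huv r hr⟩
  have hg : ContDiff ℝ ∞ (fun r : ℝ ↦ (r, θT + ι * (r - rT))) :=
    contDiff_id.prodMk (contDiff_const.add (contDiff_const.mul (contDiff_id.sub contDiff_const)))
  have h1 : ContDiffOn ℝ ∞ ((fun p : ℝ × ℝ ↦ twistAngle c p.1 p.2) ∘ (fun r : ℝ ↦ (r, θT + ι * (r - rT)))) (Ioo u v) :=
    (contDiffOn_twistAngle c).comp hg.contDiffOn hmap
  exact (contDiffOn_id.mul h1.sin).congr fun r _ ↦ rfl

/-- **The stub angle stays admissible near the tip.** [folklore] -/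
theorem exists_stubAngle_mem (ι : ℝ) {θT : ℝ} (rT : ℝ) (hθT : θT ∈ Ioo (-π) π) :
    ∃ ℓ > 0, ∀ r ∈ Ioo (rT - ℓ) (rT + ℓ), θT + ι * (r - rT) ∈ Ioo (-π) π := by
  obtain ⟨d, hd, hdd⟩ : ∃ d > 0, ∀ x, |x| < d → θT + x ∈ Ioo (-π) π :=
    ⟨min (θT + π) (π - θT), lt_min (by linarith [hθT.1]) (by linarith [hθT.2]), fun x hx ↦ by
      rw [abs_lt] at hx
      constructor <;> nlinarith [min_le_left (θT + π) (π - θT), min_le_right (θT + π) (π - θT)]⟩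
  refine ⟨d / (|ι| + 1), div_pos hd (by positivity), fun r hr ↦ hdd _ ?_⟩
  have h1 : |r - rT| < d / (|ι| + 1) := by rw [abs_lt]; constructor <;> linarith [hr.1, hr.2]
  calc |ι * (r - rT)| = |ι| * |r - rT| := abs_mul _ _
    _ ≤ |ι| * (d / (|ι| + 1)) := by gcongr
    _ < d := by
      rw [mul_div_assoc']
      rw [div_lt_iff₀ (by positivity)]
      nlinarith [abs_nonneg ι]

/-- **The twisted stub is a graph near a vertical tip**: `Y` has positive derivative on a
neighbourhood of `r_T`. [folklore] -/
theorem exists_deriv_stubY_pos (c ι : ℝ) {θT : ℝ} (rT : ℝ) (hθT : θT ∈ Ioo (-π) π)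
    (htip : twistAngle c rT θT = π / 2) :
    ∃ ℓ > 0, (∀ r ∈ Ioo (rT - ℓ) (rT + ℓ), θT + ι * (r - rT) ∈ Ioo (-π) π) ∧
      ∀ r ∈ Ioo (rT - ℓ) (rT + ℓ), 0 < deriv (fun r ↦ r * sin (twistAngle c r (θT + ι * (r - rT)))) r := by
  obtain ⟨ℓ₀, hℓ₀, hmem⟩ := exists_stubAngle_mem ι rT hθT
  have hsm := contDiffOn_stubY c ι θT rT hmem
  have hcont : ContinuousOn (deriv fun r ↦ r * sin (twistAngle c r (θT + ι * (r - rT)))) (Ioo (rT - ℓ₀) (rT + ℓ₀)) :=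
    (hsm.continuousOn_deriv_of_isOpen isOpen_Ioo (by simp))
  have hrT : rT ∈ Ioo (rT - ℓ₀) (rT + ℓ₀) := ⟨by linarith, by linarith⟩
  have hpos : 0 < deriv (fun r ↦ r * sin (twistAngle c r (θT + ι * (r - rT)))) rT := by
    rw [deriv_stubY_tip c ι rT hθT htip]; exact one_pos
  have hev : ∀ᶠ r in 𝓝 rT, 0 < deriv (fun r ↦ r * sin (twistAngle c r (θT + ι * (r - rT)))) r :=
    (hcont.continuousAt (Ioo_mem_nhds hrT.1 hrT.2)).eventually (Ioi_mem_nhds hpos) |>.mono fun r hr ↦ hr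
  obtain ⟨ℓ₁, hℓ₁, hball⟩ := Metric.eventually_nhds_iff.1 hev
  refine ⟨min ℓ₀ ℓ₁, lt_min hℓ₀ hℓ₁, fun r hr ↦ hmem r ⟨by linarith [hr.1, min_le_left ℓ₀ ℓ₁], by linarith [hr.2, min_le_left ℓ₀ ℓ₁]⟩,
    fun r hr ↦ hball ?_⟩
  rw [Real.dist_eq, abs_lt]
  constructor <;> linarith [hr.1, hr.2, min_le_right ℓ₀ ℓ₁]

/-- **Consequently `Y` is strictly increasing near the tip** (so the twisted stub is the graph of
`X ∘ Y⁻¹` over the second coordinate there). [folklore] -/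
theorem exists_strictMonoOn_stubY (c ι : ℝ) {θT : ℝ} (rT : ℝ) (hθT : θT ∈ Ioo (-π) π)
    (htip : twistAngle c rT θT = π / 2) :
    ∃ ℓ > 0, (∀ r ∈ Ioo (rT - ℓ) (rT + ℓ), θT + ι * (r - rT) ∈ Ioo (-π) π) ∧
      (∀ r ∈ Ioo (rT - ℓ) (rT + ℓ), 0 < deriv (fun r ↦ r * sin (twistAngle c r (θT + ι * (r - rT)))) r) ∧
      StrictMonoOn (fun r ↦ r * sin (twistAngle c r (θT + ι * (r - rT)))) (Ioo (rT - ℓ) (rT + ℓ)) := by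
  obtain ⟨ℓ, hℓ, hmem, hpos⟩ := exists_deriv_stubY_pos c ι rT hθT htip
  refine ⟨ℓ, hℓ, hmem, hpos, ?_⟩
  have hsm := contDiffOn_stubY c ι θT rT hmem
  exact strictMonoOn_of_deriv_pos (convex_Ioo _ _) hsm.continuousOn fun r hr ↦ hpos r (by simpa [interior_Ioo] using hr)

end Literature.Topology.FourManifolds
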